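import Mathlib
import HarnessLib
import HarnessLib.Audit
import Summits.PneNP.Statement
import Literature.Computability.Complexity.CNF
import Literature.Computability.MetaComplexity.Frege
import Literature.Computability.MetaComplexity.ProofSystems
import Literature.Computability.MetaComplexity.Resolution
import Literature.Computability.MetaComplexity.PolynomialCalculus
import Summits.PneNP.PneNP.Theorems.SoloBlindCorridorMap
import HarnessLib.Audit.Status.Attr

/-!
Route: PrimalityPlaces

# Route PrimalityPlaces — primality has no short proofs — bit-level proof systems see only the
places 2 and ∞

It suffices to show X = "no Cook–Reckhow proof system for TAUT is polynomially bounded" (NP ≠ coNP;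
the shared target of
ProofCplx / AperiodicTorus / ExpanderLinearGenerators), climbed on ONE new explicit, P-uniform,
symmetry-free family: the
DIOPHANTINE CNFs of Krajíček–Pudlák's primality tautologies σ_p — "x·y = p" on a fixed array
multiplier (balanced n-bit
factors, p a 2n-bit prime), its carry-free algebraic shadow Σ 2^(i+j) x_i y_j = p, and the Pell-type
family "x·x = 17·(y·y)", y odd (√17 ∉ ℚ) — with the
squares "x·x = N" kept only on the provable EASY side (TwoAdicObstructionEasy; rev 2, after the
planner's CDCL experiment showed x² = N
is easy at both places: 2-adic and real square roots pin x).
Realises card primes-dyadic-archimedean. The rungs (resolution width and size, PC/ℚ degree, the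
2-versus-∞ dichotomy for
squares, Extended Frege) are the cruxes; the family meets X through ONE declared crux,
EFPrimalityReachesX ("EF hardness of the
primes family suffices for X": EFPrimalityHard ⇒ EF not p-bounded (provable glue) ⇒ X by the
Krajíček–Pudlák sufficiency link "EF is
p-bounded if any proof system is", vacuous if NP ≠ coNP), so that the deciding theorem is crux-only:
`closes (h6 : EFPrimalityHard) (h7 : EFPrimalityReachesX) (hB : TautBridge) : PneNP := hB (h7 h6)`
through the proved bridge TautBridge;
X stays filed as the target (thesis) item.
Lean: `¬ Literature.Computability.MetaComplexity.HasPolyBoundedProofSystem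
Literature.Computability.Complexity.TAUT`

## Assembly
Pure logic, crux-only: `closes (h6 : EFPrimalityHard) (h7 : EFPrimalityReachesX) (hB : TautBridge) :
PneNP := hB (h7 h6)` (glue.lean) —
both binders are cruxes of this route and TautBridge is the PROVED shared bridge
(Summit.PneNP.PneNP.Theorems.tautBridge_proof), so no
unproved support enters the deciding theorem; the target X is h7 h6. The Assembly item
`EFPrimalityHard → EFPrimalityReachesX → PneNP` is provable now from the landed
bridge (`example (hB : TautBridge) : Assembly := fun h6 h7 => hB (h7 h6)`, Sketch rc 0) and is not a
tautology over the items. The lower rungs (resolution size/width, PC degree, squares) do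
not enter the chain: they establish the place-by-place mechanism on the family from the bottom, as
in every ladder route.

Rationale: WHY THIS LINE. A proof system that reads bits reasons PLACE BY PLACE: the low columns of a
multiplier carry exactly the 2-adic information
(x·y ≡ p mod 2^k is solvable in odd x, y for every k — Hensel), the high columns the archimedean
information (x·y ≈ p is
solvable in reals, and in integers up to the precision of the top columns), and "p is prime" has NO
obstruction at 2 or at ∞ —
it is a purely global fact; so a refutation must couple Ω(n) low columns to Ω(n) high columns
through carry chains, which is
what width/size/degree lower bounds should charge for (a two-front Delayer: 2-adic below,
archimedean above, free carries in
the gap). The object is posed ON this problem and calibrated at the top — KrajicekPudlak1998 §4 (σ_p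
as EF candidates; Thm 12:
all σ_p have p-size EF proofs iff some NP-definition of primality is S¹₂-provably sound; Prop 2/Thm
3: S¹₂-provable
equivalences put factoring in P; "we do not know any lower bounds for the tautologies in any proof
system"), Jeřábek's WF =
EF + dWPHP upper bound via Pratt (KrajicekProofComplexity2019 p.402) — and EMPTY below EF for 28
years; imported: elementary
local–global number theory (2-adic squares, pseudosquares), the width/size technology of
BenSassonWigderson2001, the knapsack
degree bounds of ImpagliazzoPudlakSgall1999 / arXiv:1606.05050 and the binary-value principle of
arXiv:1911.06738 /
arXiv:2010.05660 (nearest algebraic prior art: ONE binary value, conditional IPS / Ext-PC size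
bounds; ours is a PRODUCT of two
binary values, attained without the top-bit constraints), Beame–Liew's critical strips
(arXiv:1705.04302: the same
array-multiplier CNFs have poly-size regular-resolution proofs of ring IDENTITIES — identities are
strip-local, primality is
not). What no prior PneNP route does: every proof-complexity route here climbs on combinatorial or
linear-algebraic families
(PHP, Tseitin/linear systems, random CSP, Ramsey, designs, tilings, lattices); this is the first
Diophantine family (one
integer in, no S_n, no parity, no pigeons in its syntax), the opposite local–global direction to
BruckRyserSos (there a
Hasse–Minkowski obstruction EXISTS and SoS is blind to it; here none exists and Res/PC see only ℚ₂ ×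
ℝ), and the EF tier reads
PRIMES as the natural EF-versus-WF separator ("EF cannot count succinctly"); doi:10.1145/3801091
(Pich–Santhanam) is why EF
lower bounds for explicit P-uniform families are the live frontier toward the summit; since σ_p is a
P-recognisable set of
tautologies (AKS) it is easy for SOME proof system, so the family can only ever witness hardness of
specific systems — the route
says so and routes its top through ONE explicit crux (EFPrimalityReachesX = EF-not-p-bounded plus
the Krajíček–Pudlák sufficiency link) rather
than pretending σ_p is hard for all systems.

RANKED CRUXES. #0 NoPolyBoundedProofSystem (target) — X — no Cook–Reckhow proof system for TAUT is
polynomially bounded (NP ≠ coNP); shared decl of ProofCplx / AperiodicTorus /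
ExpanderLinearGenerators / MatroidTseitin. (why it might fail: X ⇔ NP ≠ coNP: false iff some proof
system, however unnatural, is p-bounded; no superpolynomial lower bound is known for any system from
Frege up, and X does not follow from any single rung below.) [CookReckhow1979,
KrajicekProofComplexity2019, KrajicekPudlak1998]
#2 ResolutionCannotProvePrimality (crux) — RESOLUTION CANNOT PROVE PRIMALITY (card K1, balanced
form, one fixed encoding): there are ε > 0 and N such that for all n ≥ N and every prime p with
4^(n−1) ≤ p < 4^n, every resolution refutation of balancedCNF n p — the Tseitin CNF of the n×n array
multiplier (partial products x_i∧y_j, row-wise ripple-carry accumulation, XOR3/MAJ full adders) with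
output bits set to p and unit clauses x_(n−1) = y_(n−1) = 1 ("p is not a product of two n-bit
numbers", the RSA-shaped core of σ_p; all clauses of width ≤ 4) — has at least 2^(n^ε) lines.
Intended route: PrimalityWidthHard plus a "prescribed binary digits" random-restriction step that
preserves 2-adic and archimedean solubility (width alone cannot give size here: Θ(n²) variables).
[difficulty: open-problem] (why it might fail: Beame–Liew critical strips (pathwidth O(log n)) might
let a dag-like refutation sweep xy ≡ p (mod 2^k) upward and ⌊xy/2^k⌋ downward and meet in the middle
in quasi-poly size; Mersenne/Fermat-type primes may leak structure; no size technique without width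
is known here.) [KrajicekPudlak1998, arXiv:1705.04302, BenSassonWigderson2001, Haken1985,
arXiv:1902.01448]
#3 PrimalityWidthHard (crux) — PRIMALITY HAS LINEAR RESOLUTION WIDTH (the two-front adversary as a
theorem; the engine of the line): there are ε > 0 and N such that for n ≥ N and every prime p ∈
[4^(n−1), 4^n) every resolution refutation of balancedCNF n p has width ≥ ε·n (initial width is 4,
so this is meaningful). Duplicator for the εn-pebble game: pebbles in the low columns answered by a
genuine 2-adic solution (x odd free, y ≡ p·x⁻¹), pebbles in the high columns by a genuine integer
pair with the right top columns, middle bits free, carries entering an unpebbled column treated as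
free; fewer than εn pebbles never link the fronts. Gives tree-like size 2^Ω(n) (support
TreeLikePrimalityHard) and is the first kit-checkable prediction. [difficulty: L] (why it might
fail: Pebbles are reusable: a Spoiler sweeping the array row by row with polylog pebbles (a dynamic
programme, as for Tseitin on a path) may expose the lie in the middle band where clauses mix low
bits, high bits and carries; products with prescribed low AND high digits may not exist at width
o(n).) [BenSassonWigderson2001, AtseriasDalmau2008, KrajicekPudlak1998, arXiv:1705.04302]
#4 CarryFreeKnapsackDegree (crux) — THE CARRY-FREE SHADOW (card K2, made non-vacuous by unit side
constraints): there are c > 0 and N such that for n ≥ N, every prime p ∈ [4^(n−1), 4^n) and m + 1 =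
n, every polynomial-calculus refutation over ℚ of the bilinear binary-value system { Σ_(i,j≤m)
2^(i+j) x_i y_j − p, x_m − 1, y_m − 1 } (Boolean axioms built in; all axioms of degree ≤ 2) has
degree ≥ c·n / log n — primality with the carries algebraised away; the product of TWO binary
values, where arXiv:1911.06738's binary value principle has one. [difficulty: M] (why it might fail:
IPS99/FSTW knapsack bounds need the target outside the Boolean range of the form, but p IS attained
once the top-bit units are dropped, so a low-degree refutation may route through the units; or the
bound holds merely because PC/ℚ is parity-blind — true but silent about primality.)
[ImpagliazzoPudlakSgall1999, arXiv:1606.05050, arXiv:1911.06738, arXiv:2010.05660,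
KrajicekProofComplexity2019]
#5 PellConicHard (crux) — √17 ∉ ℚ IS HARD FOR RESOLUTION (the dichotomy at 2 and ∞, hard side;
REPAIRED in rev 1 from PseudoSquaresHard = x² = N pseudosquares, which the planner's own CDCL run
kit j021235 refuted in spirit: ≈ 0 conflicts up to n = 30, because for squares both places pin x):
there are ε > 0 and N₀ such that for n ≥ N₀ every resolution refutation of pell17CNF n — two blocks
of the fixed array multiplier (x·x, y·y on n-bit x, y), a ripple adder for y² + 16y², equality with
x², unit y_0 = 1 (WLOG), width ≤ 4, a TALLY family — has ≥ 2^(n^ε) lines. 17 is a 2-adic square and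
positive: no obstruction at 2 or ∞; the obstructions at 3, 5, 7, … need divisibility descent
invisible to clauses. CDCL on this encoding: x² = 3y² 0 conflicts for all n ≤ 28, x² = 17y² ≈
2^(0.82·n) conflicts (2.0·10⁶ at n = 20, timeout at 22) — harder than balanced factoring (≈
2^(0.59·n)). (why it might fail: the multiplier/adder auxiliaries might let resolution express
residues of x, y mod 3 compactly and run the 3-adic descent; near-solutions x/y ≈ √17 are sparse
(units of ℤ[√17]) and an archimedean interval sweep might exploit it.) [KrajicekPudlak1998,
BenSassonWigderson2001, arXiv:1705.04302, Haken1985]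
#6 EFPrimalityHard (crux) — EF NEEDS SUCCINCT COUNTING FOR PRIMES (card K4 = the negation of
Krajíček–Pudlák's §4 question): for every Frege system F and every k, for infinitely many n there is
an n-bit prime p such that every extended-Frege proof over F of ¬primeCNF n p (the full σ_p: n-bit
x, y, output p, wide clauses x ≠ 1, y ≠ 1) has size > n^k. By KP98 Thm 12 this says no NP-definition
of primality has S¹₂-provable soundness; the known upper bound is WF = EF + dWPHP(PV) via Pratt
certificates (Jeřábek), so the crux isolates PRIMES as an EF-versus-WF separator; it implies "EF is
not p-bounded" (ProofCplx rung) and is where the family meets X. [difficulty: open-problem] (why it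
might fail: An AKS-type certificate ((x+a)^p ≡ x^p + a mod (p, x^r − 1), a ≤ poly n) might admit an
S¹₂-provable soundness proof replacing the group-order counting by explicit polynomial identities,
giving p-size EF proofs of every σ_p; and non-uniform EF proofs may use p-specific structure
invisible to S¹₂.) [KrajicekPudlak1998, KrajicekProofComplexity2019,
doi:10.4007/annals.2004.160.781, doi:10.1002/malq.200910009, CookReckhow1979, doi:10.1145/3801091]
#7 EFPrimalityReachesX (crux) — EF HARDNESS OF THE PRIMES FAMILY SUFFICES FOR X (the rung through
which the family touches the thesis, filed as one crux so that the deciding theorem is crux-only):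
EFPrimalityHard → no Cook–Reckhow proof system for TAUT is polynomially bounded. It factors as (a)
EFPrimalityHard ⇒ EF is not polynomially bounded (support EFPrimalityGivesEFNotPolyBounded, provable
now: |σ_p| = O(n²)) — i.e. Cook–Reckhow's EF problem, crux ProofcplxEfNotPbounded of route ProofCplx
— and (b) the Krajíček–Pudlák sufficiency/optimality link "EF is polynomially bounded if ANY proof
system for TAUT is" (a p-bounded system is optimal; does EF then prove its reflection principle in
polynomial size?). Since σ_p is a P-recognisable set of tautologies (AKS) it is easy for SOME proof
system, so no family-level "hard for all systems" claim is made — (b) is the honest open link.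
[deps: EFPrimalityHard] [difficulty: open-problem] (why it might fail: Link (b) is vacuously true if
NP ≠ coNP but may FAIL in an NP = coNP world: the p-bounded system could be EF + reflection axioms
that EF cannot prove in polynomial size (Pudlák's finite-consistency conjectures), leaving EF hard
on σ_p while X is false.) [KrajicekPudlak1989, KoblerMessnerToran2003, KrajicekPudlak1998,
CookReckhow1979, KrajicekProofComplexity2019, doi:10.1145/3801091]
#9 EFPrimalityGivesEFNotPolyBounded (support) — (glue (a) of crux 7, provable now) EFPrimalityHard →
extended Frege is not polynomially bounded (for every Frege system F, ¬F.IsEFPolyBounded — verbatim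
the statement of ProofCplx's crux ProofcplxEfNotPbounded): the tautology ¬primeCNF n p has size ≤
c·n² (Θ(n²) clauses, total literal count O(n²)), so a polynomial bound q(φ.size) on EF-proof size
would give every σ_p an EF-proof of size ≤ q(c n²) ≤ n^k for one fixed k and all large n,
contradicting "for every k, infinitely many σ_p need size > n^k". [difficulty: provable-now]
[CookReckhow1979, KrajicekPudlak1998]
#9 TreeLikePrimalityHard (support) — (the tree-like rung; follows from PrimalityWidthHard by the
tree-like size–width relation S_tree ≥ 2^(w − w₀) with w₀ = 4, BenSassonWigderson2001 — prove it
that way, or directly by a two-front Prover–Delayer strategy) for some ε > 0 and all large n, every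
TREE-LIKE resolution refutation of balancedCNF n p (p prime in [4^(n−1), 4^n)) has ≥ 2^(εn) lines —
DPLL cannot certify primality; the calibration rung under the empirical SAT-factoring wall.
[difficulty: M] [BenSassonWigderson2001, KrajicekProofComplexity2019, arXiv:1902.01448]
#9 TwoAdicObstructionEasy (support) — (the easy side of the dichotomy, provable now) there is c such
that for all n ≥ 1 and 0 < N < 4^n that is NOT of the form 4^j·u with u ≡ 1 (mod 8) (i.e. N is not a
2-adic square: odd 2-valuation, or odd part ≢ 1 mod 8), squareCNF n N has a resolution refutation
with ≤ c·n³ lines: derive x_0 = … = x_(j−1) = 0 column by column (each forced by a zero output bit),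
then the O(1)-variable contradiction in columns 2j…2j+2 (x² ≡ 0, 1, 4 mod 8). [difficulty: M]
[arXiv:1705.04302, KrajicekProofComplexity2019]
#9 BalancedCNFCorrect (support) — (encoding correctness, provable now; checked by evaluation for n ≤
4 in the planner's EvalCNF.lean) for n ≥ 1 and p < 4^n, balancedCNF n p is satisfiable iff p = x·y
for some x, y with 2^(n−1) ≤ x, y < 2^n; in particular it is an unsatisfiable width-4 CNF with Θ(n²)
clauses for every prime p ∈ [4^(n−1), 4^n). [difficulty: provable-now] [arXiv:1705.04302,
KrajicekPudlak1998]
#9 PellCNFCorrect (support) — (encoding correctness of the Pell-type family, provable now; x², y²,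
y²+16y² checked by evaluation for n ≤ 4) for n ≥ 1, pell17CNF n is satisfiable iff some x, y < 2^n
with y odd satisfy x·x = 17·(y·y) — hence never (√17 ∉ ℚ), so ¬pell17CNF n is a tautology of size
Θ(n²) for every n. [difficulty: provable-now] [arXiv:1705.04302, KrajicekPudlak1998]
#9 PrimeCNFCorrect (support) — (encoding correctness of the full σ_p used by the EF crux, provable
now) for n ≥ 1 and p < 2^n, primeCNF n p is satisfiable iff p = x·y with x, y < 2^n and x ≠ 1 ≠ y;
hence ¬primeCNF n p is a tautology iff p is prime or p = 1, of size O(n²), P-uniform in (n, p).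
[difficulty: provable-now] [KrajicekPudlak1998, arXiv:1705.04302]
#9 TautBridge (support) — (shared with ProofCplx/AperiodicTorus, already proved:
Summit.PneNP.PneNP.Theorems.tautBridge_proof) X → PneNP over the tree's classes: if P = NP then coNP
= P ⊆ NP, so TAUT ∈ NP has a p-bounded proof system. [difficulty: provable-now] [CookReckhow1979,
AroraBarakCC2009]

TWO-LAYER PLAN. Foreseen glued splits, none filed now: ResolutionCannotProvePrimality ⇐
(PrimalityWidthHard) → (PrescribedDigitsRestriction: a
distribution of restrictions fixing εn² of the multiplier's variables to a genuine low-column /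
high-column computation under
which every small refutation becomes narrow) → K1; PellConicHard ⇐ (Pell-width ≥ εn: the same
two-front Duplicator, the archimedean front now the line x ≈ √17·y) → (same restriction step);
EFPrimalityHard ⇐ (uniform form: S¹₂ + dWPHP-free fragments ⊬ Pratt/AKS soundness, KP98 Thm 12
direction) → (KPT witnessing
to a factoring-type consequence). A bounded-depth Frege rung (switching lemma for multiplier CNFs)
and a Cutting-Planes rung
(the LP relaxation of the linearised multiplier is feasible = the archimedean place is free; CP rank
as the price of 2-adic
reasoning) are the natural next children once Width closes.

KILL CRITERIA. Polynomial (or 2^(n^o(1)))-size resolution refutations of balancedCNF n p for all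
large primes refute K1 and with it the
mechanism: close `refuted:ResolutionCannotProvePrimality`. Width-O(log n) refutations refute
PrimalityWidthHard AND K1 (size
n^O(w)): close. A refutation of PrimalityWidthHard at intermediate width only weakens the tree-like
rung; K1 stays.
PellConicHard refuted (poly-size resolution proofs of √17 ∉ ℚ, e.g. a clause-level 3-adic descent) ⇒
drop the Pell branch and record
that odd places ARE visible to resolution — which would also threaten the mechanism behind K1
(re-examine before continuing). CarryFreeKnapsackDegree refuted ⇒ drop K2 (the algebraic shadow is
not the obstruction).
EFPrimalityHard refuted — p-size EF proofs of all σ_p, answering KP98 §4 — removes the rung meeting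
X: close `exhausted` (the
family cannot separate EF) unless K1 is by then a theorem worth keeping as a Literature fact. EF
proved p-bounded refutes EFPrimalityHard,
EFPrimalityReachesX's glue and ProofCplx #4 alike: close. EFPrimalityReachesX itself can only be
refuted by exhibiting a p-bounded
proof system (NP = coNP) that EF does not match — that world closes the summit's proof-complexity
routes wholesale. X proved by any sibling route
(ProofCplx, AperiodicTorus, …) closes this one `superseded`, happily; ¬X (a p-bounded proof system)
closes all ladder routes.

NOT DECOMPOSED YET. The restriction step for K1 (its constants and the distribution), the AC⁰-Frege
and CP rungs, the uniform bounded-arithmetic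
form of the EF crux, average-case versions over random primes, other Diophantine families with no
local obstruction
(x² − 17y², norm forms), other Pell-type slopes D ≡ 1 (mod 8) (the crux fixes D = 17; a version
uniform in D needs a constant-multiplier block), and any robustness over multiplier ENCODINGS —
deliberately not claimed:
a bound for all poly-size multiplier circuits would hand resolution the extension variables of EF (=
K4-strength).

CHEAPEST FALSIFIER. (i) Computation — RUN by the planner before/at open, results attached as route
evidence (evidence-cdcl-part1.md, evidence-cdcl-part2.md; kit j021077, j021079, j021235; CaDiCaL
DRAT on THIS encoding, n = operand bits): families with a 2-adic obstruction are refuted by UNIT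
PROPAGATION ALONE at every size (x² = N with N ≡ 5 mod 8: 0 conflicts, n ≤ 28; N = 4^j·u descent: 0
conflicts; x² = 3y²: 0 conflicts, n ≤ 28), squares with N ≡ 1 (mod 8) are ALSO easy (0–312 conflicts
up to n = 30 — both places pin x; this killed the rev-0 crux PseudoSquaresHard, restated as
PellConicHard), while the families with no 2/∞ obstruction and a free parameter are exponential: σ_p
(x·y = p) ≈ 2^(0.49·n) conflicts (√p: trial division), balancedCNF (crux 2's exact family) ≈
2^(0.59·n) (2.4·10⁶ conflicts, 257 s at n = 26; timeout 500 s at n = 30), x² = 17y² ≈ 2^(0.82·n)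
(timeout at n = 22). Reading rule going forward: any CDCL/DRAT run showing polynomial growth on
balancedCNF or pell17CNF retires the corresponding crux's interest at once. (ii) Lookup: ANY bound
on σ_p since KP98 — none found (searches in Novelty; Itsykson–Riazanov CCC 2021 checked: perfect
matching / bit-PHP only). (iii) In-Lean: the inline encodings were evaluated (EvalCNF.lean,
EvalPell.lean, farm rc 0) for n ≤ 4: products, squares and y²+16y² correct on all inputs,
(un)satisfiability exactly as stated, width 4.

NUMBERS. Encoding: variables 4n² + 3n + 1, clauses 17n² − 14n + 1 + 2n + 2 (n = 3: 120, n = 4: 227,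
checked), width 4 (balanced,
square), n (full σ_p). Upper bounds: tree-like 2^n·O(n²) (decision tree on x, unit propagation of y
≡ p·x⁻¹ mod 2^n, clash in
the top columns); nothing better known dag-like; regular resolution proves degree-2 ring identities
on the same CNFs in
poly size (arXiv:1705.04302 §4–5); PC degree ≤ 2n + 2 trivially for crux 4; WF-proofs of σ_p
polynomial (Pratt + Jeřábek),
EF unknown (KP98 §4), G₃ via T²₃. 2-adic squares: N is a square in ℤ₂ iff N = 4^j·u, u ≡ 1 (mod 8)
(the easy/hard line for squares turned out to be irrelevant: all squares are CDCL-easy). Empirical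
(this route's kit runs, conflicts vs operand bits n): σ_p 32→29649 (n 8→28, ≈2^(0.49n)); balancedCNF
59→2.37·10⁶ (n 8→26, ≈2^(0.59n)); x²=17y² 776→2.04·10⁶ (n 8→20, ≈2^(0.82n)); every 2-adically
obstructed family and every plain square: 0–312 conflicts up to n = 30. pell17CNF size: 2 multiplier
blocks + a (2n+5)-position adder, 397 clauses at n = 3, 639 at n = 4.

DEFINITION REQUESTS. None blocking — CNF/Resolution/PC/Frege/EF vocabularies exist
(Literature.Computability.Complexity.CNF,
Literature.Computability.MetaComplexity.Resolution/.PolynomialCalculus/.Frege/.ProofSystems) and the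
multiplier is inlined
identically in every item (generated from one source, gen/mk_sketch.py). Wanted later, not filed
now: a named
`Literature.Computability.MetaComplexity.ArithmeticCNF` (mulAt-blocks / balancedCNF / primeCNF /
squareCNF / pell17CNF with their correctness
lemmas) so that layer-2 children can be stated compactly; KP98 Thm 12 and Jeřábek's WF upper bound
as cite facts.

Novelty: Searches (2026-08-17, this seat; local searchd reset once, S2 HTTP 429): `lit search --source
openalex "proof complexity integer factoring multiplication CNF resolution lower bound primality
tautology"` (14 rows, none on σ_p); `lit search --source arxiv "au:Itsykson au:Riazanov"` (0) and
`"Riazanov tree-like resolution"` (2: Res(⊕) games, hitting formulas — unrelated); `lit search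
--source crossref "Proof complexity of natural formulas via communication arguments"` (Krajíček
chapters only); DROPS abstract of doi:10.4230/LIPIcs.CCC.2021.3 fetched (perfect matching, bit
pigeonhole — NOT factoring; settles the triage's open check, acq-04640 re-requested); arXiv
abstracts 1911.06738 (binary value principle: conditional IPS bounds), 2010.05660 (Ext-PC bit-size
bound for BVP), 1902.01448 (SAT factoring); `lit galaxy search "Binary Value Principle" --star pdf`
(1: arXiv:2306.02184 PIT/IPS) and broad `--star all` (0); `lit search --hybrid "resolution lower
bound multiplication circuit CNF factoring primality proof complexity"` (8 books: Jukna,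
Arora–Barak, Bonacina, … — no treatment); `lit frontier PneNP --since 2023` (30: doi:10.1145/3801091
Pich–Santhanam EF→P≠NP, noted); hub: 52 Theses files and 171 cards grepped — arithmetic CNFs /
primality proofs appear only in this card (factoring elsewhere only as DECISION islands:
ultimately-hard-factorials, cyclotomic-tally-hartmanis, Kloosterman). Card's own 2026-08-16 searches
(openalex/crossref/galaxy, KP98 and Beame–Liew READ, Krajíček  [refs: 10.4230/LIPIcs.CCC.2021.3, 10.1145/3801091, 2306.02184, 1705.04302, 1911.06738, 2010.05660, doi:10.4230/LIPIcs.CCC.2021.3, doi:10.1145/3801091, KrajicekPudlak1998]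

Barriers (technique_class: proof-complexity, adversary-width, local-global): - technique_class: proof-complexity, adversary-width, local-global
- Literature.Barriers.PneNP.FeasibleInterpolationEF: relevant and respected — KP98 both erects it
(EF has no feasible interpolation under RSA) and poses our EF crux; no EF bound is claimed via
interpolation (σ_p is not a split formula); crux 6 records only witnessing consequences, cruxes 2–5
use width/restriction/degree on single formulas where interpolation is not even applicable.
- Literature.Barriers.PneNP.NaturalProofs: not engaged — no circuit lower bound or constructive
largeness property; proof-size bounds for explicit tautologies are outside Razborov–Rudich (same for
NaturalProofsTC0).
- Literature.Barriers.PneNP.Relativization: binds only the thesis-level X (NP ≠ coNP), conceded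
exactly as in ProofCplx/AperiodicTorus; the cruxes concern one explicit family and do not relativise
(oracle gates change the CNF). Same for BoundedRelativization and Algebrization.
- Literature.Barriers.PneNP.NPHardnessToOneWayFunctions: not engaged — no NP-hardness or
one-way-function claim; factoring enters only through KP98's witnessing theorems (uniform EF proofs
⇒ factoring-type algorithms), the safe direction. LatticeGapCoNP likewise not engaged.
- Literature.Barriers.PneNP.CompositeModulusDegree: not applicable — crux 4 is PC over ℚ
(characteristic 0), not MOD_m-degree; LowDegreeCounterexamples (low-degree method) not applicable:
no planted distribution.
- Negatives index: none of the five refuted PneNP statements conc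

History (route lifecycle, newest last):
- 2026-08-17T01:29:08Z · rev 1: restated PseudoSquaresHard (stmt-PneNP-16926) — repair before staffing: planner's own cheapest-falsifier run (kit j021235) shows x^2 = N, N ≡ 1 mod 8, refuted by CDCL with ~0 conflicts up to n=30 (both places (planner-plan-novel-PneNP-PneNP-1b2e912a-v2-g12-0)
- 2026-08-17T01:29:29Z · rev 2: restated SquareCNFCorrect (stmt-PneNP-16933) — companion of the crux-5 repair: the square family leaves the route's cruxes (TwoAdicObstructionEasy keeps its own semantics inline), so its correctness support (planner-plan-novel-PneNP-PneNP-1b2e912a-v2-g12-0)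

sub-problem: PneNP · status: draft · opened planner-plan-novel-PneNP-PneNP-1b2e912a-v2-g12-0 2026-08-17T00:46:10Z · rev 3 · ledger route-PneNP-PrimalityPlaces
GENERATED by the gate from the ledger (D-0016/17). Provers cite these decls: `theorem foo : Summit.PneNP.PneNP.Theses.PrimalityPlaces.<Decl> := …` in Summits/PneNP/PneNP/Theorems/<Name>.lean.
-/

namespace Summit.PneNP.PneNP.Theses.PrimalityPlaces

open scoped BigOperators Topology Manifold Classical MeasureTheory ProbabilityTheory Matrix InnerProductSpace ComplexConjugate ContinuousMap
open Filter Set Function TopologicalSpace MeasureTheory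

attribute [summit_statement] _root_.PneNP

open Literature.PNP

/-- item stmt-PneNP-0097 · target · rank 0 · open · by planner
why it might fail: X ⇔ NP ≠ coNP: false iff some proof system, however unnatural, is p-bounded; no superpolynomial lower bound is known for any system from Frege up, and X does not follow from any single rung below.
sources: CookReckhow1979, KrajicekProofComplexity2019, KrajicekPudlak1998
No Cook–Reckhow proof system for TAUT is polynomially bounded; equivalently NP ≠ coNP
[CookReckhow1979, Prop. 1.1]. Route thesis of PneNP/ProofCplx. [sources: CookReckhow1979;
arXiv:2208.11642] -/
@[route_item "route-PneNP-PrimalityPlaces"]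
def NoPolyBoundedProofSystem : Prop :=
  ¬ Literature.Computability.MetaComplexity.HasPolyBoundedProofSystem Literature.Computability.Complexity.TAUT

/-- item stmt-PneNP-16923 · crux · rank 2 · open · by planner
why it might fail: Beame–Liew critical strips (pathwidth O(log n)) might let a dag-like refutation sweep xy ≡ p (mod 2^k) upward and ⌊xy/2^k⌋ downward and meet in the middle in quasi-poly size; Mersenne/Fermat-type primes may leak structure; no size technique without width is known here.
sources: KrajicekPudlak1998, arXiv:1705.04302, BenSassonWigderson2001, Haken1985, arXiv:1902.01448
[crux] RESOLUTION CANNOT PROVE PRIMALITY (card K1, balanced form, one fixed encoding): there are ε >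
0 and N such that for all n ≥ N and every prime p with 4^(n−1) ≤ p < 4^n, every resolution
refutation of balancedCNF n p — the Tseitin CNF of the n×n array multiplier (partial products
x_i∧y_j, row-wise ripple-carry accumulation, XOR3/MAJ full adders) with output bits set to p and
unit clauses x_(n−1) = y_(n−1) = 1 ("p is not a product of two n-bit numbers", the RSA-shaped core
of σ_p; all clauses of width ≤ 4) — has at least 2^(n^ε) lines. Intended route: PrimalityWidthHard
plus a "prescribed binary digits" random-restriction step that preserves 2-adic and archimedean
solubility (width alone cannot give size here: Θ(n²) variables). [difficulty: open-problem] -/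
@[route_item "route-PneNP-PrimalityPlaces"]
def ResolutionCannotProvePrimality : Prop :=
  ∃ ε : ℝ, 0 < ε ∧ ∃ N : ℕ, ∀ n ≥ N, ∀ p : ℕ, p.Prime → 4 ^ (n - 1) ≤ p → p < 4 ^ n → (let X : ℕ → ℕ := fun i => i; let Y : ℕ → ℕ := fun j => n + j; let PP : ℕ → ℕ → ℕ := fun i j => 2 * n + i * n + j; let S : ℕ → ℕ → ℕ := fun i k => 2 * n + n * n + i * (2 * n) + k; let C : ℕ → ℕ → ℕ := fun i j => 2 * n + 3 * (n * n) + i * (n + 1) + j; let Z0 : ℕ := 3 * n + 4 * (n * n); let acc : ℕ → ℕ → ℕ := fun i k => if i = 0 then (if k < n then PP 0 k else Z0) else if k = 0 then PP 0 0 else if k < i then S k k else if k < n + i then S i k else C i n; let cin : ℕ → ℕ → ℕ := fun i j => if j = 0 then Z0 else C i j; let andCl : ℕ → ℕ → ℕ → Literature.Computability.Complexity.CNF ℕ := fun z a b => [[(z, false), (a, true)], [(z, false), (b, true)], [(z, true), (a, false), (b, false)]]; let xorCl : ℕ → ℕ → ℕ → ℕ → Literature.Computability.Complexity.CNF ℕ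 := fun s a b c => [[(a, false), (b, true), (c, true), (s, true)], [(a, true), (b, false), (c, true), (s, true)], [(a, true), (b, true), (c, false), (s, true)], [(a, true), (b, true), (c, true), (s, false)], [(a, false), (b, false), (c, false), (s, true)], [(a, false), (b, false), (c, true), (s, false)], [(a, false), (b, true), (c, false), (s, false)], [(a, true), (b, false), (c, false), (s, false)]]; let majCl : ℕ → ℕ → ℕ → ℕ → Literature.Computability.Complexity.CNF ℕ := fun m a b c => [[(m, false), (a, true), (b, true)], [(m, false), (a, true), (c, true)], [(m, false), (b, true), (c, true)], [(m, true), (a, false), (b, false)], [(m, true), (a, false), (c, false)], [(m, true), (b, false), (c, false)]]; let mulCNF : Literature.Computability.Complexity.CNF ℕ := [[(Z0, false)]] ++ ((List.range n).flatMap fun i => (List.range n).flatMap fun j => andCl (PP i j) (X i) (Y j)) ++ ((List.range n).flatMap fun i => if i = 0 then [] else (List.range n).flatMap fun j => xorCl (S i (i + j)) (acc (i - 1) (i + j)) (PP i j) (cin i j) ++ majCl (C i (j + 1)) (acc (i - 1) (i + j)) (PP i j) (cin i j)); let Z : ℕ → ℕ := fun k => acc (n - 1) k; let outCl : ℕ →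 Literature.Computability.Complexity.CNF ℕ := fun p => (List.range (2 * n)).map fun k => [(Z k, Nat.testBit p k)]; let balancedCNF : ℕ → Literature.Computability.Complexity.CNF ℕ := fun p => mulCNF ++ outCl p ++ [[(X (n - 1), true)], [(Y (n - 1), true)]]; ∀ π : List (Literature.Computability.MetaComplexity.ResLine ℕ), Literature.Computability.MetaComplexity.IsResRefutation (balancedCNF p) π → (2 : ℝ) ^ ((n : ℝ) ^ ε) ≤ (π.length : ℝ))

/-- item stmt-PneNP-16924 · crux · rank 3 · open · by planner
why it might fail: Pebbles are reusable: a Spoiler sweeping the array row by row with polylog pebbles (a dynamic programme, as for Tseitin on a path) may expose the lie in the middle band where clauses mix low bits, high bits and carries; products with prescribed low AND high digits may not exist at width o(n).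
sources: BenSassonWigderson2001, AtseriasDalmau2008, KrajicekPudlak1998, arXiv:1705.04302
[crux] PRIMALITY HAS LINEAR RESOLUTION WIDTH (the two-front adversary as a theorem; the engine of
the line): there are ε > 0 and N such that for n ≥ N and every prime p ∈ [4^(n−1), 4^n) every
resolution refutation of balancedCNF n p has width ≥ ε·n (initial width is 4, so this is
meaningful). Duplicator for the εn-pebble game: pebbles in the low columns answered by a genuine
2-adic solution (x odd free, y ≡ p·x⁻¹), pebbles in the high columns by a genuine integer pair with
the right top columns, middle bits free, carries entering an unpebbled column treated as free; fewer
than εn pebbles never link the fronts. Gives tree-like size 2^Ω(n) (support TreeLikePrimalityHard)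
and is the first kit-checkable prediction. [difficulty: L] -/
@[route_item "route-PneNP-PrimalityPlaces"]
def PrimalityWidthHard : Prop :=
  ∃ ε : ℝ, 0 < ε ∧ ∃ N : ℕ, ∀ n ≥ N, ∀ p : ℕ, p.Prime → 4 ^ (n - 1) ≤ p → p < 4 ^ n → (let X : ℕ → ℕ := fun i => i; let Y : ℕ → ℕ := fun j => n + j; let PP : ℕ → ℕ → ℕ := fun i j => 2 * n + i * n + j; let S : ℕ → ℕ → ℕ := fun i k => 2 * n + n * n + i * (2 * n) + k; let C : ℕ → ℕ → ℕ := fun i j => 2 * n + 3 * (n * n) + i * (n + 1) + j; let Z0 : ℕ := 3 * n + 4 * (n * n); let acc : ℕ → ℕ → ℕ := fun i k => if i = 0 then (if k < n then PP 0 k else Z0) else if k = 0 then PP 0 0 else if k < i then S k k else if k < n + i then S i k else C i n; let cin : ℕ → ℕ → ℕ := fun i j => if j = 0 then Z0 else C i j; let andCl : ℕ → ℕ → ℕ → Literature.Computability.Complexity.CNF ℕ := fun z a b => [[(z, false), (a, true)], [(z, false), (b, true)], [(z, true), (a, false), (b, false)]]; let xorCl : ℕ → ℕ → ℕ → ℕ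 → Literature.Computability.Complexity.CNF ℕ := fun s a b c => [[(a, false), (b, true), (c, true), (s, true)], [(a, true), (b, false), (c, true), (s, true)], [(a, true), (b, true), (c, false), (s, true)], [(a, true), (b, true), (c, true), (s, false)], [(a, false), (b, false), (c, false), (s, true)], [(a, false), (b, false), (c, true), (s, false)], [(a, false), (b, true), (c, false), (s, false)], [(a, true), (b, false), (c, false), (s, false)]]; let majCl : ℕ → ℕ → ℕ → ℕ → Literature.Computability.Complexity.CNF ℕ := fun m a b c => [[(m, false), (a, true), (b, true)], [(m, false), (a, true), (c, true)], [(m, false), (b, true), (c, true)], [(m, true), (a, false), (b, false)], [(m, true), (a, false), (c, false)], [(m, true), (b, false), (c, false)]]; let mulCNF : Literature.Computability.Complexity.CNF ℕ := [[(Z0, false)]] ++ ((List.range n).flatMap fun i => (List.range n).flatMap fun j => andCl (PP i j) (X i) (Y j)) ++ ((List.range n).flatMap fun i => if i = 0 then [] else (List.range n).flatMap fun j => xorCl (S i (i + j)) (acc (i - 1) (i + j)) (PP i j) (cin i j) ++ majCl (C i (j + 1)) (acc (i - 1) (i + j)) (PP i j) (cin i j)); let Z : ℕ → ℕ := fun k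 => acc (n - 1) k; let outCl : ℕ → Literature.Computability.Complexity.CNF ℕ := fun p => (List.range (2 * n)).map fun k => [(Z k, Nat.testBit p k)]; let balancedCNF : ℕ → Literature.Computability.Complexity.CNF ℕ := fun p => mulCNF ++ outCl p ++ [[(X (n - 1), true)], [(Y (n - 1), true)]]; ∀ π : List (Literature.Computability.MetaComplexity.ResLine ℕ), Literature.Computability.MetaComplexity.IsResRefutation (balancedCNF p) π → ε * (n : ℝ) ≤ (Literature.Computability.MetaComplexity.resWidth π : ℝ))

/-- item stmt-PneNP-16925 · crux · rank 4 · open · by planner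
why it might fail: IPS99/FSTW knapsack bounds need the target outside the Boolean range of the form, but p IS attained once the top-bit units are dropped, so a low-degree refutation may route through the units; or the bound holds merely because PC/ℚ is parity-blind — true but silent about primality.
sources: ImpagliazzoPudlakSgall1999, arXiv:1606.05050, arXiv:1911.06738, arXiv:2010.05660, KrajicekProofComplexity2019
[crux] THE CARRY-FREE SHADOW (card K2, made non-vacuous by unit side constraints): there are c > 0
and N such that for n ≥ N, every prime p ∈ [4^(n−1), 4^n) and m + 1 = n, every polynomial-calculus
refutation over ℚ of the bilinear binary-value system { Σ_(i,j≤m) 2^(i+j) x_i y_j − p, x_m − 1, y_m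
− 1 } (Boolean axioms built in; all axioms of degree ≤ 2) has degree ≥ c·n / log n — primality with
the carries algebraised away; the product of TWO binary values, where arXiv:1911.06738's binary
value principle has one. [difficulty: M] -/
@[route_item "route-PneNP-PrimalityPlaces"]
def CarryFreeKnapsackDegree : Prop :=
  ∃ c : ℝ, 0 < c ∧ ∃ N : ℕ, ∀ n ≥ N, ∀ p : ℕ, p.Prime → 4 ^ (n - 1) ≤ p → p < 4 ^ n → ∀ m : ℕ, m + 1 = n → (let P : MvPolynomial (Fin (m + 1) ⊕ Fin (m + 1)) ℚ := (∑ i : Fin (m + 1), ∑ j : Fin (m + 1), MvPolynomial.C ((2 : ℚ) ^ (i.1 + j.1)) * MvPolynomial.X (Sum.inl i) * MvPolynomial.X (Sum.inr j)) - MvPolynomial.C (p : ℚ); let 𝓕 : Set (MvPolynomial (Fin (m + 1) ⊕ Fin (m + 1)) ℚ) := {P, MvPolynomial.X (Sum.inl (Fin.last m)) - 1, MvPolynomial.X (Sum.inr (Fin.last m)) - 1}; ∀ d : ℕ, Literature.Computability.MetaComplexity.PC.RefutableInDegree 𝓕 d → c * (n : ℝ) / Real.log (n : ℝ) ≤ (d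 : ℝ))

/-- item stmt-PneNP-17158 · crux · rank 5 · open · by planner
why it might fail: @why_pell.txt
sources: KrajicekPudlak1998, BenSassonWigderson2001, arXiv:1705.04302, Haken1985
[crux] √17 ∉ ℚ IS HARD FOR RESOLUTION — the dichotomy at 2 and ∞, hard side; REPAIRED 2026-08-17
from PseudoSquaresHard after the planner's CDCL experiment (kit j021235) showed x² = N with N ≡ 1
(mod 8) is refuted with ≈ 0 conflicts for n ≤ 30: for squares BOTH places pin x (2-adic and real
square roots), so the archimedean isqrt refutation that item's why-might-fail warned of exists.
Statement: there are ε > 0 and N₀ such that for n ≥ N₀ every resolution refutation of pell17CNF n —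
two blocks of the route's fixed array multiplier computing x·x and y·y on n-bit x, y, a ripple adder
computing y² + 16·y², bitwise equality with x² (and zero overflow), and the unit clause y_0 = 1
(WLOG: a minimal solution of x² = 17y² has y odd), all clauses of width ≤ 4, a TALLY family (one CNF
per n, no integer parameter) — has ≥ 2^(n^ε) lines. 17 ≡ 1 (mod 8) is a 2-adic square and positive,
so there is no obstruction at 2 or at ∞; the obstructions at 3, 5, 7, … (17 a non-residue) need
divisibility descent, invisible to clauses over bits. CDCL data on this encoding (kit
j021077/j021235; y ≠ 0 variant): x² = 3y² is refuted with 0 conflicts for every n ≤ 28 (2-adic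
obstruction ⇒ unit propagation), x² = -/
@[route_item "route-PneNP-PrimalityPlaces"]
def PellConicHard : Prop :=
  ∃ ε : ℝ, 0 < ε ∧ ∃ N₀ : ℕ, ∀ n ≥ N₀, (let X : ℕ → ℕ := fun i => i; let Y : ℕ → ℕ := fun j => n + j; let PP : ℕ → ℕ → ℕ → ℕ := fun o i j => o + i * n + j; let S : ℕ → ℕ → ℕ → ℕ := fun o i k => o + n * n + i * (2 * n) + k; let C : ℕ → ℕ → ℕ → ℕ := fun o i j => o + 3 * (n * n) + i * (n + 1) + j; let Z0 : ℕ → ℕ := fun o => o + 4 * (n * n) + n; let acc : ℕ → ℕ → ℕ → ℕ := fun o i k => if i = 0 then (if k < n then PP o 0 k else Z0 o) else if k = 0 then PP o 0 0 else if k < i then S o k k else if k < n + i then S o i k else C o i n; let cin : ℕ → ℕ → ℕ → ℕ := fun o i j => if j = 0 then Z0 o else C o i j; let andCl : ℕ → ℕ → ℕ → Literature.Computability.Complexity.CNF ℕ := fun z a b => [[(z, false), (a, true)], [(z, false), (b, true)], [(z, true), (a, false), (b, false)]]; let xorCl : ℕ → ℕ → ℕ → ℕ → Literature.Computability.Complexity.CNF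 ℕ := fun s a b c => [[(a, false), (b, true), (c, true), (s, true)], [(a, true), (b, false), (c, true), (s, true)], [(a, true), (b, true), (c, false), (s, true)], [(a, true), (b, true), (c, true), (s, false)], [(a, false), (b, false), (c, false), (s, true)], [(a, false), (b, false), (c, true), (s, false)], [(a, false), (b, true), (c, false), (s, false)], [(a, true), (b, false), (c, false), (s, false)]]; let majCl : ℕ → ℕ → ℕ → ℕ → Literature.Computability.Complexity.CNF ℕ := fun m a b c => [[(m, false), (a, true), (b, true)], [(m, false), (a, true), (c, true)], [(m, false), (b, true), (c, true)], [(m, true), (a, false), (b, false)], [(m, true), (a, false), (c, false)], [(m, true), (b, false), (c, false)]]; let mulAt : ℕ → (ℕ → ℕ) → (ℕ → ℕ) → Literature.Computability.Complexity.CNF ℕ := fun o xa ya => [[(Z0 o, false)]] ++ ((List.range n).flatMap fun i => (List.range n).flatMap fun j => andCl (PP o i j) (xa i) (ya j)) ++ ((List.range n).flatMap fun i => if i = 0 then [] else (List.range n).flatMap fun j => xorCl (S o i (i + j)) (acc o (i - 1) (i + j)) (PP o i j) (cin o i j) ++ majCl (C o i (j + 1)) (acc o (i - 1) (i + j)) (PP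 o i j) (cin o i j)); let o1 : ℕ := 2 * n; let o2 : ℕ := 2 * n + (4 * (n * n) + n + 1); let o3 : ℕ := 2 * n + 2 * (4 * (n * n) + n + 1); let Q : ℕ → ℕ := fun k => if k < 2 * n then acc o2 (n - 1) k else Z0 o2; let B : ℕ → ℕ := fun k => if k < 4 then Z0 o2 else Q (k - 4); let U : ℕ → ℕ := fun k => o3 + k; let V : ℕ → ℕ := fun k => o3 + (2 * n + 5) + k; let ci : ℕ → ℕ := fun k => if k = 0 then Z0 o2 else V (k - 1); let addCNF : Literature.Computability.Complexity.CNF ℕ := (List.range (2 * n + 5)).flatMap fun k => xorCl (U k) (Q k) (B k) (ci k) ++ majCl (V k) (Q k) (B k) (ci k); let pell17CNF : Literature.Computability.Complexity.CNF ℕ := mulAt o1 X X ++ mulAt o2 Y Y ++ addCNF ++ ((List.range (2 * n)).flatMap fun k => [[(U k, false), (acc o1 (n - 1) k, true)], [(U k, true), (acc o1 (n - 1) k, false)]]) ++ ((List.range 5).map fun t => [(U (2 * n + t), false)]) ++ [[(V (2 * n + 4), false)], [(Y 0, true)]]; ∀ π : List (Literature.Computability.MetaComplexity.ResLine ℕ),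 Literature.Computability.MetaComplexity.IsResRefutation pell17CNF π → (2 : ℝ) ^ ((n : ℝ) ^ ε) ≤ (π.length : ℝ))

/-- item stmt-PneNP-16927 · crux · rank 6 · open · by planner
why it might fail: An AKS-type certificate ((x+a)^p ≡ x^p + a mod (p, x^r − 1), a ≤ poly n) might admit an S¹₂-provable soundness proof replacing the group-order counting by explicit polynomial identities, giving p-size EF proofs of every σ_p; and non-uniform EF proofs may use p-specific structure invisible to S¹₂.
sources: KrajicekPudlak1998, KrajicekProofComplexity2019, doi:10.4007/annals.2004.160.781, doi:10.1002/malq.200910009, CookReckhow1979, doi:10.1145/3801091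
[crux] EF NEEDS SUCCINCT COUNTING FOR PRIMES (card K4 = the negation of Krajíček–Pudlák's §4
question): for every Frege system F and every k, for infinitely many n there is an n-bit prime p
such that every extended-Frege proof over F of ¬primeCNF n p (the full σ_p: n-bit x, y, output p,
wide clauses x ≠ 1, y ≠ 1) has size > n^k. By KP98 Thm 12 this says no NP-definition of primality
has S¹₂-provable soundness; the known upper bound is WF = EF + dWPHP(PV) via Pratt certificates
(Jeřábek), so the crux isolates PRIMES as an EF-versus-WF separator; it implies "EF is not
p-bounded" (ProofCplx rung) and is where the family meets X. [difficulty: open-problem] -/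
@[route_item "route-PneNP-PrimalityPlaces", crux]
def EFPrimalityHard : Prop :=
  ∀ F : Literature.Computability.MetaComplexity.FregeSystem, Literature.Computability.MetaComplexity.IsFrege F → ∀ k N₀ : ℕ, ∃ n ≥ N₀, ∃ p : ℕ, p.Prime ∧ 2 ^ (n - 1) ≤ p ∧ p < 2 ^ n ∧ (let X : ℕ → ℕ := fun i => i; let Y : ℕ → ℕ := fun j => n + j; let PP : ℕ → ℕ → ℕ := fun i j => 2 * n + i * n + j; let S : ℕ → ℕ → ℕ := fun i k => 2 * n + n * n + i * (2 * n) + k; let C : ℕ → ℕ → ℕ := fun i j => 2 * n + 3 * (n * n) + i * (n + 1) + j; let Z0 : ℕ := 3 * n + 4 * (n * n); let acc : ℕ → ℕ → ℕ := fun i k => if i = 0 then (if k < n then PP 0 k else Z0) else if k = 0 then PP 0 0 else if k < i then S k k else if k < n + i then S i k else C i n; let cin : ℕ → ℕ → ℕ := fun i j => if j = 0 then Z0 else C i j; let andCl : ℕ → ℕ → ℕ → Literature.Computability.Complexity.CNF ℕ := fun z a b => [[(z, false), (a, true)], [(z, false), (b, true)], [(z, true), (a, false), (b, false)]]; let xorCl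 : ℕ → ℕ → ℕ → ℕ → Literature.Computability.Complexity.CNF ℕ := fun s a b c => [[(a, false), (b, true), (c, true), (s, true)], [(a, true), (b, false), (c, true), (s, true)], [(a, true), (b, true), (c, false), (s, true)], [(a, true), (b, true), (c, true), (s, false)], [(a, false), (b, false), (c, false), (s, true)], [(a, false), (b, false), (c, true), (s, false)], [(a, false), (b, true), (c, false), (s, false)], [(a, true), (b, false), (c, false), (s, false)]]; let majCl : ℕ → ℕ → ℕ → ℕ → Literature.Computability.Complexity.CNF ℕ := fun m a b c => [[(m, false), (a, true), (b, true)], [(m, false), (a, true), (c, true)], [(m, false), (b, true), (c, true)], [(m, true), (a, false), (b, false)], [(m, true), (a, false), (c, false)], [(m, true), (b, false), (c, false)]]; let mulCNF : Literature.Computability.Complexity.CNF ℕ := [[(Z0, false)]] ++ ((List.range n).flatMap fun i => (List.range n).flatMap fun j => andCl (PP i j) (X i) (Y j)) ++ ((List.range n).flatMap fun i => if i = 0 then [] else (List.range n).flatMap fun j => xorCl (S i (i + j)) (acc (i - 1) (i + j)) (PP i j) (cin i j) ++ majCl (C i (j + 1)) (acc (i - 1) (i + j)) (PP i j) (cin i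 j)); let Z : ℕ → ℕ := fun k => acc (n - 1) k; let outCl : ℕ → Literature.Computability.Complexity.CNF ℕ := fun p => (List.range (2 * n)).map fun k => [(Z k, Nat.testBit p k)]; let primeCNF : ℕ → Literature.Computability.Complexity.CNF ℕ := fun p => mulCNF ++ outCl p ++ [((X 0, false) :: (List.range (n - 1)).map fun i => (X (i + 1), true)), ((Y 0, false) :: (List.range (n - 1)).map fun j => (Y (j + 1), true))]; ∀ π : List (Literature.Computability.Complexity.PropForm ℕ), F.IsEFProofOf π (Literature.Computability.Complexity.PropForm.neg (Literature.Computability.Complexity.PropForm.ofCNF (primeCNF p))) → n ^ k < Literature.Computability.MetaComplexity.proofSize π)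

/-- item stmt-PneNP-16928 · crux · rank 7 · open · by planner
why it might fail: Link (b) is vacuously true if NP ≠ coNP but may FAIL in an NP = coNP world: the p-bounded system could be EF + reflection axioms that EF cannot prove in polynomial size (Pudlák's finite-consistency conjectures), leaving EF hard on σ_p while X is false.
sources: KrajicekPudlak1989, KoblerMessnerToran2003, KrajicekPudlak1998, CookReckhow1979, KrajicekProofComplexity2019, doi:10.1145/3801091
[crux] EF HARDNESS OF THE PRIMES FAMILY SUFFICES FOR X (the rung through which the family touches
the thesis, filed as one crux so that the deciding theorem is crux-only): EFPrimalityHard → no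
Cook–Reckhow proof system for TAUT is polynomially bounded. It factors as (a) EFPrimalityHard ⇒ EF
is not polynomially bounded (support EFPrimalityGivesEFNotPolyBounded, provable now: |σ_p| = O(n²))
— i.e. Cook–Reckhow's EF problem, crux ProofcplxEfNotPbounded of route ProofCplx — and (b) the
Krajíček–Pudlák sufficiency/optimality link "EF is polynomially bounded if ANY proof system for TAUT
is" (a p-bounded system is optimal; does EF then prove its reflection principle in polynomial
size?). Since σ_p is a P-recognisable set of tautologies (AKS) it is easy for SOME proof system, so
no family-level "hard for all systems" claim is made — (b) is the honest open link. [deps: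
EFPrimalityHard] [difficulty: open-problem] -/
@[route_item "route-PneNP-PrimalityPlaces", crux]
def EFPrimalityReachesX : Prop :=
  EFPrimalityHard → ¬ Literature.Computability.MetaComplexity.HasPolyBoundedProofSystem Literature.Computability.Complexity.TAUT

/-- item stmt-PneNP-16929 · support · rank 9 · open · by planner
sources: CookReckhow1979, KrajicekPudlak1998
[support] (glue (a) of crux 7, provable now) EFPrimalityHard → extended Frege is not polynomially
bounded (for every Frege system F, ¬F.IsEFPolyBounded — verbatim the statement of ProofCplx's crux
ProofcplxEfNotPbounded): the tautology ¬primeCNF n p has size ≤ c·n² (Θ(n²) clauses, total literal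
count O(n²)), so a polynomial bound q(φ.size) on EF-proof size would give every σ_p an EF-proof of
size ≤ q(c n²) ≤ n^k for one fixed k and all large n, contradicting "for every k, infinitely many
σ_p need size > n^k". [difficulty: provable-now] -/
@[route_item "route-PneNP-PrimalityPlaces"]
def EFPrimalityGivesEFNotPolyBounded : Prop :=
  EFPrimalityHard → ∀ F : Literature.Computability.MetaComplexity.FregeSystem, Literature.Computability.MetaComplexity.IsFrege F → ¬ F.IsEFPolyBounded

/-- item stmt-PneNP-16930 · support · rank 9 · open · by planner
sources: BenSassonWigderson2001, KrajicekProofComplexity2019, arXiv:1902.01448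
[support] (the tree-like rung; follows from PrimalityWidthHard by the tree-like size–width relation
S_tree ≥ 2^(w − w₀) with w₀ = 4, BenSassonWigderson2001 — prove it that way, or directly by a
two-front Prover–Delayer strategy) for some ε > 0 and all large n, every TREE-LIKE resolution
refutation of balancedCNF n p (p prime in [4^(n−1), 4^n)) has ≥ 2^(εn) lines — DPLL cannot certify
primality; the calibration rung under the empirical SAT-factoring wall. [difficulty: M] -/
@[route_item "route-PneNP-PrimalityPlaces"]
def TreeLikePrimalityHard : Prop :=
  ∃ ε : ℝ, 0 < ε ∧ ∃ N : ℕ, ∀ n ≥ N, ∀ p : ℕ, p.Prime → 4 ^ (n - 1) ≤ p → p < 4 ^ n → (let X : ℕ → ℕ := fun i => i; let Y : ℕ → ℕ := fun j => n + j; let PP : ℕ → ℕ → ℕ := fun i j => 2 * n + i * n + j; let S : ℕ → ℕ → ℕ := fun i k => 2 * n + n * n + i * (2 * n) + k; let C : ℕ → ℕ → ℕ := fun i j => 2 * n + 3 * (n * n) + i * (n + 1) + j; let Z0 : ℕ := 3 * n + 4 * (n * n); let acc : ℕ → ℕ → ℕ := fun i k => if i = 0 then (if k < n then PP 0 k else Z0)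 else if k = 0 then PP 0 0 else if k < i then S k k else if k < n + i then S i k else C i n; let cin : ℕ → ℕ → ℕ := fun i j => if j = 0 then Z0 else C i j; let andCl : ℕ → ℕ → ℕ → Literature.Computability.Complexity.CNF ℕ := fun z a b => [[(z, false), (a, true)], [(z, false), (b, true)], [(z, true), (a, false), (b, false)]]; let xorCl : ℕ → ℕ → ℕ → ℕ → Literature.Computability.Complexity.CNF ℕ := fun s a b c => [[(a, false), (b, true), (c, true), (s, true)], [(a, true), (b, false), (c, true), (s, true)], [(a, true), (b, true), (c, false), (s, true)], [(a, true), (b, true), (c, true), (s, false)], [(a, false), (b, false), (c, false), (s, true)], [(a, false), (b, false), (c, true), (s, false)], [(a, false), (b, true), (c, false), (s, false)], [(a, true), (b, false), (c, false), (s, false)]]; let majCl : ℕ → ℕ → ℕ → ℕ → Literature.Computability.Complexity.CNF ℕ := fun m a b c => [[(m, false), (a, true), (b, true)], [(m, false), (a, true), (c, true)], [(m, false), (b, true), (c, true)], [(m, true), (a, false), (b, false)], [(m, true), (a, false), (c, false)], [(m, true), (b, false), (c, false)]]; let mulCNF : Literature.Computability.Complexity.CNF ℕ := [[(Z0, false)]]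 ++ ((List.range n).flatMap fun i => (List.range n).flatMap fun j => andCl (PP i j) (X i) (Y j)) ++ ((List.range n).flatMap fun i => if i = 0 then [] else (List.range n).flatMap fun j => xorCl (S i (i + j)) (acc (i - 1) (i + j)) (PP i j) (cin i j) ++ majCl (C i (j + 1)) (acc (i - 1) (i + j)) (PP i j) (cin i j)); let Z : ℕ → ℕ := fun k => acc (n - 1) k; let outCl : ℕ → Literature.Computability.Complexity.CNF ℕ := fun p => (List.range (2 * n)).map fun k => [(Z k, Nat.testBit p k)]; let balancedCNF : ℕ → Literature.Computability.Complexity.CNF ℕ := fun p => mulCNF ++ outCl p ++ [[(X (n - 1), true)], [(Y (n - 1), true)]]; ∀ π : List (Literature.Computability.MetaComplexity.ResLine ℕ), Literature.Computability.MetaComplexity.IsResRefutation (balancedCNF p) π → Literature.Computability.MetaComplexity.IsTreeLike π → (2 : ℝ) ^ (ε * (n : ℝ)) ≤ (π.length : ℝ))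

/-- item stmt-PneNP-16931 · support · rank 9 · open · by planner
sources: arXiv:1705.04302, KrajicekProofComplexity2019
[support] (the easy side of the dichotomy, provable now) there is c such that for all n ≥ 1 and 0 <
N < 4^n that is NOT of the form 4^j·u with u ≡ 1 (mod 8) (i.e. N is not a 2-adic square: odd
2-valuation, or odd part ≢ 1 mod 8), squareCNF n N has a resolution refutation with ≤ c·n³ lines:
derive x_0 = … = x_(j−1) = 0 column by column (each forced by a zero output bit), then the
O(1)-variable contradiction in columns 2j…2j+2 (x² ≡ 0, 1, 4 mod 8). [difficulty: M] -/
@[route_item "route-PneNP-PrimalityPlaces"]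
def TwoAdicObstructionEasy : Prop :=
  ∃ c : ℕ, ∀ n ≥ 1, ∀ N : ℕ, 0 < N → N < 4 ^ n → (¬ ∃ j u : ℕ, N = 4 ^ j * u ∧ u % 8 = 1) → (let X : ℕ → ℕ := fun i => i; let Y : ℕ → ℕ := fun j => n + j; let PP : ℕ → ℕ → ℕ := fun i j => 2 * n + i * n + j; let S : ℕ → ℕ → ℕ := fun i k => 2 * n + n * n + i * (2 * n) + k; let C : ℕ → ℕ → ℕ := fun i j => 2 * n + 3 * (n * n) + i * (n + 1) + j; let Z0 : ℕ := 3 * n + 4 * (n * n); let acc : ℕ → ℕ → ℕ := fun i k => if i = 0 then (if k < n then PP 0 k else Z0) else if k = 0 then PP 0 0 else if k < i then S k k else if k < n + i then S i k else C i n; let cin : ℕ → ℕ → ℕ := fun i j => if j = 0 then Z0 else C i j; let andCl : ℕ → ℕ → ℕ → Literature.Computability.Complexity.CNF ℕ := fun z a b => [[(z, false), (a, true)], [(z, false), (b, true)], [(z, true), (a, false), (b, false)]]; let xorCl : ℕ → ℕ → ℕ → ℕ → Literature.Computability.Complexity.CNF ℕ := fun s a b c => [[(a, false), (b, true), (c,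 true), (s, true)], [(a, true), (b, false), (c, true), (s, true)], [(a, true), (b, true), (c, false), (s, true)], [(a, true), (b, true), (c, true), (s, false)], [(a, false), (b, false), (c, false), (s, true)], [(a, false), (b, false), (c, true), (s, false)], [(a, false), (b, true), (c, false), (s, false)], [(a, true), (b, false), (c, false), (s, false)]]; let majCl : ℕ → ℕ → ℕ → ℕ → Literature.Computability.Complexity.CNF ℕ := fun m a b c => [[(m, false), (a, true), (b, true)], [(m, false), (a, true), (c, true)], [(m, false), (b, true), (c, true)], [(m, true), (a, false), (b, false)], [(m, true), (a, false), (c, false)], [(m, true), (b, false), (c, false)]]; let mulCNF : Literature.Computability.Complexity.CNF ℕ := [[(Z0, false)]] ++ ((List.range n).flatMap fun i => (List.range n).flatMap fun j => andCl (PP i j) (X i) (Y j)) ++ ((List.range n).flatMap fun i => if i = 0 then [] else (List.range n).flatMap fun j => xorCl (S i (i + j)) (acc (i - 1) (i + j)) (PP i j) (cin i j) ++ majCl (C i (j + 1)) (acc (i - 1) (i + j)) (PP i j) (cin i j)); let Z : ℕ → ℕ := fun k => acc (n - 1) k; let outCl : ℕ → Literature.Computability.Complexity.CNF ℕ := fun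 p => (List.range (2 * n)).map fun k => [(Z k, Nat.testBit p k)]; let squareCNF : ℕ → Literature.Computability.Complexity.CNF ℕ := fun N => mulCNF ++ outCl N ++ ((List.range n).flatMap fun i => [[(X i, false), (Y i, true)], [(X i, true), (Y i, false)]]); ∃ π : List (Literature.Computability.MetaComplexity.ResLine ℕ), Literature.Computability.MetaComplexity.IsResRefutation (squareCNF N) π ∧ π.length ≤ c * n ^ 3)

/-- item stmt-PneNP-16932 · support · rank 9 · open · by planner
sources: arXiv:1705.04302, KrajicekPudlak1998
[support] (encoding correctness, provable now; checked by evaluation for n ≤ 4 in the planner's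
EvalCNF.lean) for n ≥ 1 and p < 4^n, balancedCNF n p is satisfiable iff p = x·y for some x, y with
2^(n−1) ≤ x, y < 2^n; in particular it is an unsatisfiable width-4 CNF with Θ(n²) clauses for every
prime p ∈ [4^(n−1), 4^n). [difficulty: provable-now] -/
@[route_item "route-PneNP-PrimalityPlaces"]
def BalancedCNFCorrect : Prop :=
  ∀ n ≥ 1, ∀ p : ℕ, p < 4 ^ n → (let X : ℕ → ℕ := fun i => i; let Y : ℕ → ℕ := fun j => n + j; let PP : ℕ → ℕ → ℕ := fun i j => 2 * n + i * n + j; let S : ℕ → ℕ → ℕ := fun i k => 2 * n + n * n + i * (2 * n) + k; let C : ℕ → ℕ → ℕ := fun i j => 2 * n + 3 * (n * n) + i * (n + 1) + j; let Z0 : ℕ := 3 * n + 4 * (n * n); let acc : ℕ → ℕ → ℕ := fun i k => if i = 0 then (if k < n then PP 0 k else Z0) else if k = 0 then PP 0 0 else if k < i then S k k else if k < n + i then S i k else C i n; let cin : ℕ → ℕ → ℕ := fun i j => if j = 0 then Z0 else C i j; let andCl : ℕ → ℕ → ℕ → Literature.Computability.Complexity.CNF ℕ := fun z a b => [[(z,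 false), (a, true)], [(z, false), (b, true)], [(z, true), (a, false), (b, false)]]; let xorCl : ℕ → ℕ → ℕ → ℕ → Literature.Computability.Complexity.CNF ℕ := fun s a b c => [[(a, false), (b, true), (c, true), (s, true)], [(a, true), (b, false), (c, true), (s, true)], [(a, true), (b, true), (c, false), (s, true)], [(a, true), (b, true), (c, true), (s, false)], [(a, false), (b, false), (c, false), (s, true)], [(a, false), (b, false), (c, true), (s, false)], [(a, false), (b, true), (c, false), (s, false)], [(a, true), (b, false), (c, false), (s, false)]]; let majCl : ℕ → ℕ → ℕ → ℕ → Literature.Computability.Complexity.CNF ℕ := fun m a b c => [[(m, false), (a, true), (b, true)], [(m, false), (a, true), (c, true)], [(m, false), (b, true), (c, true)], [(m, true), (a, false), (b, false)], [(m, true), (a, false), (c, false)], [(m, true), (b, false), (c, false)]]; let mulCNF : Literature.Computability.Complexity.CNF ℕ := [[(Z0, false)]] ++ ((List.range n).flatMap fun i => (List.range n).flatMap fun j => andCl (PP i j) (X i) (Y j)) ++ ((List.range n).flatMap fun i => if i = 0 then [] else (List.range n).flatMap fun j => xorCl (S i (i + j)) (acc (i - 1) (i + j)) (PP i j) (cin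 i j) ++ majCl (C i (j + 1)) (acc (i - 1) (i + j)) (PP i j) (cin i j)); let Z : ℕ → ℕ := fun k => acc (n - 1) k; let outCl : ℕ → Literature.Computability.Complexity.CNF ℕ := fun p => (List.range (2 * n)).map fun k => [(Z k, Nat.testBit p k)]; let balancedCNF : ℕ → Literature.Computability.Complexity.CNF ℕ := fun p => mulCNF ++ outCl p ++ [[(X (n - 1), true)], [(Y (n - 1), true)]]; ((balancedCNF p).Satisfiable ↔ ∃ x y : ℕ, 2 ^ (n - 1) ≤ x ∧ x < 2 ^ n ∧ 2 ^ (n - 1) ≤ y ∧ y < 2 ^ n ∧ x * y = p))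

/-- item stmt-PneNP-16934 · support · rank 9 · open · by planner
sources: KrajicekPudlak1998, arXiv:1705.04302
[support] (encoding correctness of the full σ_p used by the EF crux, provable now) for n ≥ 1 and p <
2^n, primeCNF n p is satisfiable iff p = x·y with x, y < 2^n and x ≠ 1 ≠ y; hence ¬primeCNF n p is a
tautology iff p is prime or p = 1, of size O(n²), P-uniform in (n, p). [difficulty: provable-now] -/
@[route_item "route-PneNP-PrimalityPlaces"]
def PrimeCNFCorrect : Prop :=
  ∀ n ≥ 1, ∀ p : ℕ, p < 2 ^ n → (let X : ℕ → ℕ := fun i => i; let Y : ℕ → ℕ := fun j => n + j; let PP : ℕ → ℕ → ℕ := fun i j => 2 * n + i * n + j; let S : ℕ → ℕ → ℕ := fun i k => 2 * n + n * n + i * (2 * n) + k; let C : ℕ → ℕ → ℕ := fun i j => 2 * n + 3 * (n * n) + i * (n + 1) + j; let Z0 : ℕ := 3 * n + 4 * (n * n); let acc : ℕ → ℕ → ℕ := fun i k => if i = 0 then (if k < n then PP 0 k else Z0) else if k = 0 then PP 0 0 else if k < i then S k k else if k < n + i then S i k else C i n; let cin : ℕ → ℕ → ℕ := fun i j => if j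 = 0 then Z0 else C i j; let andCl : ℕ → ℕ → ℕ → Literature.Computability.Complexity.CNF ℕ := fun z a b => [[(z, false), (a, true)], [(z, false), (b, true)], [(z, true), (a, false), (b, false)]]; let xorCl : ℕ → ℕ → ℕ → ℕ → Literature.Computability.Complexity.CNF ℕ := fun s a b c => [[(a, false), (b, true), (c, true), (s, true)], [(a, true), (b, false), (c, true), (s, true)], [(a, true), (b, true), (c, false), (s, true)], [(a, true), (b, true), (c, true), (s, false)], [(a, false), (b, false), (c, false), (s, true)], [(a, false), (b, false), (c, true), (s, false)], [(a, false), (b, true), (c, false), (s, false)], [(a, true), (b, false), (c, false), (s, false)]]; let majCl : ℕ → ℕ → ℕ → ℕ → Literature.Computability.Complexity.CNF ℕ := fun m a b c => [[(m, false), (a, true), (b, true)], [(m, false), (a, true), (c, true)], [(m, false), (b, true), (c, true)], [(m, true), (a, false), (b, false)], [(m, true), (a, false), (c, false)], [(m, true), (b, false), (c, false)]]; let mulCNF : Literature.Computability.Complexity.CNF ℕ := [[(Z0, false)]] ++ ((List.range n).flatMap fun i => (List.range n).flatMap fun j => andCl (PP i j) (X i) (Y j)) ++ ((List.range n).flatMap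 fun i => if i = 0 then [] else (List.range n).flatMap fun j => xorCl (S i (i + j)) (acc (i - 1) (i + j)) (PP i j) (cin i j) ++ majCl (C i (j + 1)) (acc (i - 1) (i + j)) (PP i j) (cin i j)); let Z : ℕ → ℕ := fun k => acc (n - 1) k; let outCl : ℕ → Literature.Computability.Complexity.CNF ℕ := fun p => (List.range (2 * n)).map fun k => [(Z k, Nat.testBit p k)]; let primeCNF : ℕ → Literature.Computability.Complexity.CNF ℕ := fun p => mulCNF ++ outCl p ++ [((X 0, false) :: (List.range (n - 1)).map fun i => (X (i + 1), true)), ((Y 0, false) :: (List.range (n - 1)).map fun j => (Y (j + 1), true))]; ((primeCNF p).Satisfiable ↔ ∃ x y : ℕ, x < 2 ^ n ∧ y < 2 ^ n ∧ x ≠ 1 ∧ y ≠ 1 ∧ x * y = p))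

/-- item stmt-PneNP-16935 · support · rank 9 · closed · proved by Summit.PneNP.PneNP.Theorems.SoloBlind.pneNP_of_not_hasPolyBoundedProofSystem_TAUT @ daa2c40760ec (planner) · by planner
sources: CookReckhow1979, AroraBarakCC2009
[support] (shared with ProofCplx/AperiodicTorus, already proved:
Summit.PneNP.PneNP.Theorems.tautBridge_proof) X → PneNP over the tree's classes: if P = NP then coNP
= P ⊆ NP, so TAUT ∈ NP has a p-bounded proof system. [difficulty: provable-now] -/
@[route_item "route-PneNP-PrimalityPlaces", crux]
def TautBridge : Prop :=
  ¬ Literature.Computability.MetaComplexity.HasPolyBoundedProofSystem Literature.Computability.Complexity.TAUT → PneNP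

/-- `TautBridge` holds: proved by `Summit.PneNP.PneNP.Theorems.SoloBlind.pneNP_of_not_hasPolyBoundedProofSystem_TAUT` @ daa2c40760ec. -/
theorem TautBridge_holds : TautBridge := _root_.Summit.PneNP.PneNP.Theorems.SoloBlind.pneNP_of_not_hasPolyBoundedProofSystem_TAUT

/-- item stmt-PneNP-17159 · support · rank 9 · open · by planner
sources: arXiv:1705.04302, KrajicekPudlak1998
[support] encoding correctness for the Pell-type family (provable now; REPLACES SquareCNFCorrect
together with the crux repair; checked by evaluation for n ≤ 4: the blocks compute x², y² and y² +
16y² correctly on all inputs): for n ≥ 1, pell17CNF n is satisfiable iff some x, y < 2^n with y odd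
satisfy x·x = 17·(y·y) — hence never (√17 ∉ ℚ; Mathlib irrational_sqrt of a prime /
Nat.Prime.irrational_sqrt), so ¬pell17CNF n is a tautology of size Θ(n²) for every n ≥ 1.
[difficulty: provable-now] [sources: arXiv:1705.04302; KrajicekPudlak1998] -/
@[route_item "route-PneNP-PrimalityPlaces"]
def PellCNFCorrect : Prop :=
  ∀ n ≥ 1, (let X : ℕ → ℕ := fun i => i; let Y : ℕ → ℕ := fun j => n + j; let PP : ℕ → ℕ → ℕ → ℕ := fun o i j => o + i * n + j; let S : ℕ → ℕ → ℕ → ℕ := fun o i k => o + n * n + i * (2 * n) + k; let C : ℕ → ℕ → ℕ → ℕ := fun o i j => o + 3 * (n * n) + i * (n + 1) + j; let Z0 : ℕ → ℕ := fun o => o + 4 * (n * n) + n; let acc : ℕ → ℕ → ℕ → ℕ := fun o i k => if i = 0 then (if k < n then PP o 0 k else Z0 o) else if k = 0 then PP o 0 0 else if k < i then S o k k else if k < n + i then S o i k else C o i n; let cin : ℕ → ℕ → ℕ → ℕ := fun o i j => if j = 0 then Z0 o else C o i j; let andCl : ℕ → ℕ → ℕ → Literature.Computability.Complexity.CNF ℕ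 := fun z a b => [[(z, false), (a, true)], [(z, false), (b, true)], [(z, true), (a, false), (b, false)]]; let xorCl : ℕ → ℕ → ℕ → ℕ → Literature.Computability.Complexity.CNF ℕ := fun s a b c => [[(a, false), (b, true), (c, true), (s, true)], [(a, true), (b, false), (c, true), (s, true)], [(a, true), (b, true), (c, false), (s, true)], [(a, true), (b, true), (c, true), (s, false)], [(a, false), (b, false), (c, false), (s, true)], [(a, false), (b, false), (c, true), (s, false)], [(a, false), (b, true), (c, false), (s, false)], [(a, true), (b, false), (c, false), (s, false)]]; let majCl : ℕ → ℕ → ℕ → ℕ → Literature.Computability.Complexity.CNF ℕ := fun m a b c => [[(m, false), (a, true), (b, true)], [(m, false), (a, true), (c, true)], [(m, false), (b, true), (c, true)], [(m, true), (a, false), (b, false)], [(m, true), (a, false), (c, false)], [(m, true), (b, false), (c, false)]]; let mulAt : ℕ → (ℕ → ℕ) → (ℕ → ℕ) → Literature.Computability.Complexity.CNF ℕ := fun o xa ya => [[(Z0 o, false)]] ++ ((List.range n).flatMap fun i => (List.range n).flatMap fun j => andCl (PP o i j) (xa i) (ya j)) ++ ((List.range n).flatMap fun i => if i = 0 then [] else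 (List.range n).flatMap fun j => xorCl (S o i (i + j)) (acc o (i - 1) (i + j)) (PP o i j) (cin o i j) ++ majCl (C o i (j + 1)) (acc o (i - 1) (i + j)) (PP o i j) (cin o i j)); let o1 : ℕ := 2 * n; let o2 : ℕ := 2 * n + (4 * (n * n) + n + 1); let o3 : ℕ := 2 * n + 2 * (4 * (n * n) + n + 1); let Q : ℕ → ℕ := fun k => if k < 2 * n then acc o2 (n - 1) k else Z0 o2; let B : ℕ → ℕ := fun k => if k < 4 then Z0 o2 else Q (k - 4); let U : ℕ → ℕ := fun k => o3 + k; let V : ℕ → ℕ := fun k => o3 + (2 * n + 5) + k; let ci : ℕ → ℕ := fun k => if k = 0 then Z0 o2 else V (k - 1); let addCNF : Literature.Computability.Complexity.CNF ℕ := (List.range (2 * n + 5)).flatMap fun k => xorCl (U k) (Q k) (B k) (ci k) ++ majCl (V k) (Q k) (B k) (ci k); let pell17CNF : Literature.Computability.Complexity.CNF ℕ := mulAt o1 X X ++ mulAt o2 Y Y ++ addCNF ++ ((List.range (2 * n)).flatMap fun k => [[(U k, false), (acc o1 (n - 1) k, true)], [(U k, true), (acc o1 (n - 1) k, false)]]) ++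 ((List.range 5).map fun t => [(U (2 * n + t), false)]) ++ [[(V (2 * n + 4), false)], [(Y 0, true)]]; (pell17CNF.Satisfiable ↔ ∃ x y : ℕ, x < 2 ^ n ∧ y < 2 ^ n ∧ y % 2 = 1 ∧ x * x = 17 * (y * y)))

/-- item stmt-PneNP-16936 · assembly · rank 1 · open · by planner
sources: CookReckhow1979, AroraBarakCC2009, KrajicekPudlak1998
[assembly] EFPrimalityHard → EFPrimalityReachesX → PneNP (the two cruxes of the deciding theorem
imply the summit; provable now from the landed bridge Summit.PneNP.PneNP.Theorems.tautBridge_proof —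
not a propositional tautology over the items, since X → PneNP is the bridge's content). -/
@[route_item "route-PneNP-PrimalityPlaces"]
def Assembly : Prop :=
  EFPrimalityHard → EFPrimalityReachesX → PneNP

-- records of items no longer active in this route (dropped / restated):
-- earlier PseudoSquaresHard (stmt-PneNP-16926, replaced 2026-08-17T01:29:08Z -> stmt-PneNP-17158): retired by None — ∃ ε : ℝ, 0 < ε ∧ ∃ N₀ : ℕ, ∀ n ≥ N₀, ∀ N : ℕ, N < 4 ^ n → ¬ IsSquare N → N % 8 = 1 → (∀ q : ℕ, q.Prime → 3 ≤ q → q ≤ n → ∃ r : ℕ, r ^ 2 % q = N % q) → (let X : ℕ → ℕ := fun i => i; let Y : ℕ → ℕ := fun j => n + j; let PP : ℕ → ℕ → ℕ := fun i j => 2 * n + i * n + j; let S : ℕ → ℕ → ℕ :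
-- earlier SquareCNFCorrect (stmt-PneNP-16933, replaced 2026-08-17T01:29:29Z -> stmt-PneNP-17159): retired by None — ∀ n ≥ 1, ∀ N : ℕ, N < 4 ^ n → (let X : ℕ → ℕ := fun i => i; let Y : ℕ → ℕ := fun j => n + j; let PP : ℕ → ℕ → ℕ := fun i j => 2 * n + i * n + j; let S : ℕ → ℕ → ℕ := fun i k => 2 * n + n * n + i * (2 * n) + k; let C : ℕ → ℕ → ℕ := fun i j => 2 * n + 3 * (n * n) + i * (n + 1) + j; let Z

/-! D-0027 §2.1 — DECIDING THEOREM (planner-authored via `route open/edit --closes-file`; by planner-plan-novel-PneNP-PneNP-1b2e912a-v2-g12-0 2026-08-17T00:46:10Z):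
its hypotheses are this route's items and its conclusion the sub-problem Statement (glue_lint), and it elaborates with this file. -/

@[closes "route-PneNP-PrimalityPlaces"] theorem closes (h6 : EFPrimalityHard) (h7 : EFPrimalityReachesX) (hB : TautBridge) : _root_.PneNP := hB (h7 h6)

end Summit.PneNP.PneNP.Theses.PrimalityPlaces
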